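import Summits.ResolutionOfSingularities.ResolutionOfSingularities.Theorems.FrobeniusClosingSteerArithResidue
import Mathlib.RingTheory.MvPolynomial.Homogeneous
import Mathlib.RingTheory.GradedAlgebra.Basic

/-!
# Crux `Steer` (stmt-ResolutionOfSingularities-16345), chain W4.1, (Par-S) hARᵒ STAGE 2, legality slot (H3): a RESIDUE zero of the binary
# residue form is made EXACT by re-choosing the lift (res-type-062 g15; blueprint `L/res-type-062/hAR-BLUEPRINT.md` S5; design note 13:14:41Z;
# over res-type-072's factor theorem `ArithResidue.linear_dvd_of_eval_eq_zero` p-id «…ArithResidue»; Theses-free support)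

OURS (campaign `res-hironaka`, rung L ★L-G4, slot W4.1; statements about the route's own objects — a binary form
`Ψ : MvPolynomial (Fin 2) S` over a LOCAL ring `S` (a run member), homogeneous of degree `d`, read in an rsop pair `(m₁, m₂) ⊆ 𝔪_S`; they replace the
role of no printed item and are NOT statements of the manuscript under review [claim: Hironaka2017, status: under-review]; AI review is weaker than expert
review). Seat res-type-062 g15. Definition-free; no Theses file is imported; nothing here is a route item.

## What is proved (pure commutative algebra)

The word `ArithBinaryResidueAt` (strat-2 (g0)) forbids a zero of the REDUCTION `Ψ̄` over the residue field `κ = S/𝔪`; res-D-pv-003's legality brick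
(#2 §2 `eval_pair_mem_sup_span_of_zero`) consumes an EXACT zero `Ψ′(a, b) = 0` in `S` with `b` (or `a`) a unit. The bridge:

* `homogeneousComponent_mul_of_isHomogeneous` — for `ℓ` homogeneous of degree `i`, `(ℓ·Q)_{i+j} = ℓ·Q_j` (Mathlib's graded structure on `MvPolynomial`).
* `homogeneousComponent_map` — homogeneous components commute with `MvPolynomial.map`.
* **`exists_exactLift_of_residue_zero`** — if `Ψ` is homogeneous of degree `d` and `Ψ̄` has a zero `(a₀ : b₀) ≠ 0` over `κ`, there are lifts `a, b ∈ S`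
  of `a₀, b₀` and a form `Ψ′` homogeneous of degree `d` with the SAME reduction `Ψ̄′ = Ψ̄`, an exact factor `b·X₀ − a·X₁`, hence `Ψ′(a, b) = 0`, and
  `Ψ − Ψ′` with all coefficients in `𝔪` (route: `Ψ̄ = ℓ̄·Q̄` by 072's factor theorem; `Ψ̄ = ℓ̄·Q̄_{d−1}`; lift `Q̄_{d−1}` coefficientwise and re-homogenise).
* `eval_mem_pow_succ_of_coeff_mem` — a form of degree `d` with coefficients in `𝔪`, evaluated at elements of `𝔪`, lies in `𝔪^(d+1)`; hence
  **`sub_sub_eval_mem_pow_succ_of_exactLift`**: the congruence `z − g² − Ψ(m₁,m₂) ∈ 𝔪^(d+1)` of the word transfers to `Ψ′`.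
* **`exists_exact_datum_of_residue_zero`** — the package H3's run-level wrapper consumes: from the (g0) datum `(g, m₁, m₂, Ψ)` and a residue zero,
  a datum `(a, b, Ψ′)` with `b` a unit or `a` a unit, `Ψ′` homogeneous of degree `d`, the same congruence, and `MvPolynomial.eval ![a, b] Ψ′ = 0`.

[folklore]
-/

-- `Summit.<S>.<S>.…` duplicates the summit name by design (single-problem summit).
set_option linter.dupNamespace false

open IsLocalRing MvPolynomial

namespace Summit.ResolutionOfSingularities.ResolutionOfSingularities.Theorems.SwitchingDichotomy

namespace ArithResidueLift

/-! ## §1 Homogeneous components of a product with a homogeneous factor; components commute with `map` -/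

section Graded

variable {σ : Type} {A : Type} [CommRing A]

/-- For `ℓ` homogeneous of degree `i`: the degree-`(i+j)` component of `ℓ·Q` is `ℓ·Q_j` (graded ring structure of `MvPolynomial`,
Mathlib's `MvPolynomial.gradedAlgebra`, used as a term-local instance inside the proof only). [folklore] -/
theorem homogeneousComponent_mul_of_isHomogeneous {ℓ : MvPolynomial σ A} {i : ℕ} (hℓ : ℓ.IsHomogeneous i)
    (Q : MvPolynomial σ A) (j : ℕ) :
    homogeneousComponent (i + j) (ℓ * Q) = ℓ * homogeneousComponent j Q := by
  classical
  letI : GradedAlgebra (homogeneousSubmodule σ A) := MvPolynomial.gradedAlgebra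
  have h := DirectSum.coe_decompose_mul_add_of_left_mem (𝒜 := homogeneousSubmodule σ A) (b := Q) (j := j)
    ((mem_homogeneousSubmodule i ℓ).mpr hℓ)
  rw [← DirectSum.Decomposition.decompose'_eq, decomposition.decompose'_apply, decomposition.decompose'_apply] at h
  exact h

omit [CommRing A] in
/-- Homogeneous components commute with coefficientwise ring maps. [folklore] -/
theorem homogeneousComponent_map {B : Type} [CommSemiring A] [CommSemiring B] (f : A →+* B) (n : ℕ) (P : MvPolynomial σ A) :
    homogeneousComponent n (map f P) = map f (homogeneousComponent n P) := by
  classical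
  ext m
  rw [coeff_homogeneousComponent, coeff_map, coeff_map, coeff_homogeneousComponent]
  split_ifs with h
  · rfl
  · rw [map_zero]

end Graded

/-! ## §2 The exact lift of a residue factorisation -/

section Lift

variable {S : Type} [CommRing S] [IsLocalRing S]

omit [IsLocalRing S] in
/-- The linear form `b·X₀ − a·X₁` is homogeneous of degree `1`. [folklore] -/
theorem isHomogeneous_linearForm (a b : S) :
    (C b * X 0 + C (-a) * X 1 : MvPolynomial (Fin 2) S).IsHomogeneous 1 := by
  have h0 : (C b * X 0 : MvPolynomial (Fin 2) S).IsHomogeneous (0 + 1) := (isHomogeneous_C _ _).mul (isHomogeneous_X _ _)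
  have h1 : (C (-a) * X 1 : MvPolynomial (Fin 2) S).IsHomogeneous (0 + 1) := (isHomogeneous_C _ _).mul (isHomogeneous_X _ _)
  simpa using h0.add h1

omit [IsLocalRing S] in
/-- The linear form `b·X₀ − a·X₁` vanishes at `(a, b)`. [folklore] -/
theorem eval_linearForm_self (a b : S) :
    MvPolynomial.eval ![a, b] (C b * X 0 + C (-a) * X 1 : MvPolynomial (Fin 2) S) = 0 := by
  simp only [map_add, map_mul, eval_C, eval_X, Matrix.cons_val_zero, Matrix.cons_val_one, map_neg]
  ring

/-- **The exact lift.** Let `Ψ` be a binary form of degree `d` over the local ring `S` whose reduction `Ψ̄` over the residue field has a zero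
`(a₀ : b₀) ≠ (0 : 0)`. Then there are lifts `a, b` of `a₀, b₀` and a binary form `Ψ′` of degree `d` over `S` with the same reduction, divisible by
`b·X₀ − a·X₁` (so `Ψ′(a, b) = 0`), such that `Ψ − Ψ′` has all its coefficients in `𝔪`. [folklore] -/
theorem exists_exactLift_of_residue_zero {d : ℕ} (Ψ : MvPolynomial (Fin 2) S) (hΨ : Ψ.IsHomogeneous d)
    {a₀ b₀ : ResidueField S} (hab : a₀ ≠ 0 ∨ b₀ ≠ 0)
    (h0 : MvPolynomial.eval ![a₀, b₀] (MvPolynomial.map (residue S) Ψ) = 0) :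
    ∃ (a b : S) (Ψ' : MvPolynomial (Fin 2) S), residue S a = a₀ ∧ residue S b = b₀ ∧ Ψ'.IsHomogeneous d ∧
      MvPolynomial.map (residue S) Ψ' = MvPolynomial.map (residue S) Ψ ∧
      (C b * X 0 + C (-a) * X 1 : MvPolynomial (Fin 2) S) ∣ Ψ' ∧
      MvPolynomial.eval ![a, b] Ψ' = 0 ∧ ∀ m, (Ψ - Ψ').coeff m ∈ maximalIdeal S := by
  classical
  obtain ⟨a, rfl⟩ := residue_surjective a₀
  obtain ⟨b, rfl⟩ := residue_surjective b₀
  set Ψb := MvPolynomial.map (residue S) Ψ with hΨb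
  have hΨbh : Ψb.IsHomogeneous d := hΨ.map _
  -- factor over the residue field
  obtain ⟨Qb, hQb⟩ := ArithResidue.linear_dvd_of_eval_eq_zero hΨbh hab h0
  -- the homogeneous part of the quotient still works (when `d ≥ 1`); when `Ψb = 0` take `Ψ' = 0`
  by_cases hzero : Ψb = 0
  · refine ⟨a, b, 0, rfl, rfl, isHomogeneous_zero _ _ _, by rw [map_zero, hzero], dvd_zero _, map_zero _, fun m => ?_⟩
    rw [sub_zero, ← residue_eq_zero_iff, ← coeff_map]
    change coeff m Ψb = 0
    rw [hzero, coeff_zero]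
  have hd : 1 ≤ d := by
    -- a non-zero form of degree `0` is a non-zero constant, which has no zero
    by_contra hlt
    have hd0 : d = 0 := by omega
    subst hd0
    apply hzero
    have hC : Ψb = C (Ψb.coeff 0) :=
      (totalDegree_eq_zero_iff_eq_C (p := Ψb)).mp (hΨbh.totalDegree hzero)
    rw [hC] at h0 ⊢
    rw [eval_C] at h0
    rw [h0, map_zero]
  -- lift the degree-(d-1) component of the quotient
  set ℓb : MvPolynomial (Fin 2) (ResidueField S) := C (residue S b) * X 0 + C (-(residue S a)) * X 1 with hℓb
  have hℓbh : ℓb.IsHomogeneous 1 := by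
    have := isHomogeneous_linearForm (S := ResidueField S) (residue S a) (residue S b)
    simpa [hℓb] using this
  have hfac : Ψb = ℓb * homogeneousComponent (d - 1) Qb := by
    have h1 : homogeneousComponent (1 + (d - 1)) (ℓb * Qb) = ℓb * homogeneousComponent (d - 1) Qb :=
      homogeneousComponent_mul_of_isHomogeneous hℓbh Qb (d - 1)
    have hd' : 1 + (d - 1) = d := by omega
    rw [hd', ← hQb, homogeneousComponent_of_mem (mem_homogeneousSubmodule d Ψb |>.mpr hΨbh), if_pos rfl] at h1
    exact h1
  obtain ⟨Q, hQ⟩ := map_surjective (residue S) residue_surjective (homogeneousComponent (d - 1) Qb)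
  set Q₁ := homogeneousComponent (d - 1) Q with hQ₁
  have hQ₁h : Q₁.IsHomogeneous (d - 1) := homogeneousComponent_isHomogeneous _ _
  have hQ₁map : MvPolynomial.map (residue S) Q₁ = homogeneousComponent (d - 1) Qb := by
    rw [hQ₁, ← homogeneousComponent_map, hQ, homogeneousComponent_of_mem
      (mem_homogeneousSubmodule _ _ |>.mpr (homogeneousComponent_isHomogeneous _ _)), if_pos rfl]
  set ℓ : MvPolynomial (Fin 2) S := C b * X 0 + C (-a) * X 1 with hℓ
  have hℓmap : MvPolynomial.map (residue S) ℓ = ℓb := by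
    simp [hℓ, hℓb, map_add, map_mul, map_C, map_X, map_neg]
  refine ⟨a, b, ℓ * Q₁, rfl, rfl, ?_, ?_, dvd_mul_right _ _, ?_, fun m => ?_⟩
  · have := (isHomogeneous_linearForm a b).mul hQ₁h
    have hd' : 1 + (d - 1) = d := by omega
    rw [hd'] at this
    simpa [hℓ] using this
  · rw [map_mul, hℓmap, hQ₁map, ← hfac]
  · rw [map_mul, show MvPolynomial.eval ![a, b] ℓ = 0 from eval_linearForm_self a b, zero_mul]
  · rw [← residue_eq_zero_iff, ← coeff_map, map_sub, map_mul, hℓmap, hQ₁map, ← hfac, ← hΨb, sub_self, coeff_zero]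

end Lift

/-! ## §3 Transfer of the cleaned-order congruence -/

section Congruence

variable {S : Type} [CommRing S] [IsLocalRing S]

/-- A binary form of degree `d` whose coefficients lie in `𝔪`, evaluated at a pair of elements of `𝔪`, lies in `𝔪^(d+1)`. [folklore] -/
theorem eval_mem_pow_succ_of_coeff_mem {d : ℕ} (Δ : MvPolynomial (Fin 2) S) (hΔ : Δ.IsHomogeneous d)
    (hcoeff : ∀ m, Δ.coeff m ∈ maximalIdeal S) {m₁ m₂ : S} (hm₁ : m₁ ∈ maximalIdeal S) (hm₂ : m₂ ∈ maximalIdeal S) :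
    MvPolynomial.eval ![m₁, m₂] Δ ∈ maximalIdeal S ^ (d + 1) := by
  classical
  rw [eval_eq']
  refine Ideal.sum_mem _ fun m hm => ?_
  have hdeg : m 0 + m 1 = d := by
    have h := hΔ (mem_support_iff.mp hm)
    rw [Finsupp.weight_apply, Finsupp.sum_fintype _ _ (by simp)] at h
    simpa [Fin.sum_univ_two] using h
  have hmon : ∏ i : Fin 2, (![m₁, m₂] i) ^ m i ∈ maximalIdeal S ^ d := by
    rw [Fin.prod_univ_two, Matrix.cons_val_zero, Matrix.cons_val_one, ← hdeg, pow_add]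
    exact Ideal.mul_mem_mul (Ideal.pow_mem_pow hm₁ _) (Ideal.pow_mem_pow hm₂ _)
  rw [pow_succ']
  exact Ideal.mul_mem_mul (hcoeff m) hmon

/-- **Congruence transfer.** If `z − g² − Ψ(m₁, m₂) ∈ 𝔪^(d+1)` and `Ψ′` is another form of degree `d` with `Ψ − Ψ′` coefficientwise in `𝔪`
(`m₁, m₂ ∈ 𝔪`), then `z − g² − Ψ′(m₁, m₂) ∈ 𝔪^(d+1)`. [folklore] -/
theorem sub_sub_eval_mem_pow_succ_of_exactLift {d : ℕ} {Ψ Ψ' : MvPolynomial (Fin 2) S} (hΨ : Ψ.IsHomogeneous d)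
    (hΨ' : Ψ'.IsHomogeneous d) (hcoeff : ∀ m, (Ψ - Ψ').coeff m ∈ maximalIdeal S) {z g m₁ m₂ : S}
    (hm₁ : m₁ ∈ maximalIdeal S) (hm₂ : m₂ ∈ maximalIdeal S)
    (hz : z - g ^ 2 - MvPolynomial.eval ![m₁, m₂] Ψ ∈ maximalIdeal S ^ (d + 1)) :
    z - g ^ 2 - MvPolynomial.eval ![m₁, m₂] Ψ' ∈ maximalIdeal S ^ (d + 1) := by
  have hΔ := eval_mem_pow_succ_of_coeff_mem (Ψ - Ψ') (hΨ.sub hΨ') hcoeff hm₁ hm₂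
  have e : z - g ^ 2 - MvPolynomial.eval ![m₁, m₂] Ψ' =
      (z - g ^ 2 - MvPolynomial.eval ![m₁, m₂] Ψ) + MvPolynomial.eval ![m₁, m₂] (Ψ - Ψ') := by
    rw [map_sub]; ring
  rw [e]
  exact Ideal.add_mem _ hz hΔ

/-- Members of an rsop pair lie in the maximal ideal (they are part of a minimal generating set of `𝔪`). Recorded here in the weak form
H3 needs: any element of `𝔪` does; the rsop clause of the word supplies `m₁, m₂ ∈ 𝔪` through `IsRsopPart.mem_maximalIdeal`-type lemmas of
the consumer. (No statement; see `exists_exact_datum_of_residue_zero`.) -/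
theorem mem_maximalIdeal_of_not_isUnit {x : S} (hx : ¬ IsUnit x) : x ∈ maximalIdeal S :=
  (mem_maximalIdeal x).mpr hx

/-- **The package for H3's run-level wrapper.** From the (g0) congruence `z − g² − Ψ(m₁, m₂) ∈ 𝔪^(d+1)` with `m₁, m₂ ∈ 𝔪`, `Ψ` homogeneous of
degree `d`, and a residue zero `(a₀ : b₀) ≠ 0` of `Ψ̄`: an EXACT datum — lifts `a, b` (one of them a unit), a form `Ψ′` of degree `d` with the same
reduction and the same congruence, divisible by `b·X₀ − a·X₁`, with `Ψ′(a, b) = 0`. [folklore] -/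
theorem exists_exact_datum_of_residue_zero {d : ℕ} {Ψ : MvPolynomial (Fin 2) S} (hΨ : Ψ.IsHomogeneous d) {z g m₁ m₂ : S}
    (hm₁ : m₁ ∈ maximalIdeal S) (hm₂ : m₂ ∈ maximalIdeal S)
    (hz : z - g ^ 2 - MvPolynomial.eval ![m₁, m₂] Ψ ∈ maximalIdeal S ^ (d + 1))
    {a₀ b₀ : ResidueField S} (hab : a₀ ≠ 0 ∨ b₀ ≠ 0)
    (h0 : MvPolynomial.eval ![a₀, b₀] (MvPolynomial.map (residue S) Ψ) = 0) :
    ∃ (a b : S) (Ψ' : MvPolynomial (Fin 2) S), (IsUnit a ∨ IsUnit b) ∧ Ψ'.IsHomogeneous d ∧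
      MvPolynomial.map (residue S) Ψ' = MvPolynomial.map (residue S) Ψ ∧
      (C b * X 0 + C (-a) * X 1 : MvPolynomial (Fin 2) S) ∣ Ψ' ∧
      MvPolynomial.eval ![a, b] Ψ' = 0 ∧
      z - g ^ 2 - MvPolynomial.eval ![m₁, m₂] Ψ' ∈ maximalIdeal S ^ (d + 1) := by
  obtain ⟨a, b, Ψ', ha, hb, hΨ', hmap, hdvd, heval, hcoeff⟩ := exists_exactLift_of_residue_zero Ψ hΨ hab h0
  refine ⟨a, b, Ψ', ?_, hΨ', hmap, hdvd, heval, sub_sub_eval_mem_pow_succ_of_exactLift hΨ hΨ' hcoeff hm₁ hm₂ hz⟩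
  rcases hab with ha0 | hb0
  · left
    rw [← ha] at ha0
    exact (residue_ne_zero_iff_isUnit a).mp ha0
  · right
    rw [← hb] at hb0
    exact (residue_ne_zero_iff_isUnit b).mp hb0

end Congruence

end ArithResidueLift

end Summit.ResolutionOfSingularities.ResolutionOfSingularities.Theorems.SwitchingDichotomy
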